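import Summits.Ventures.PercRepro.C026SlackClosedForm
import Summits.Ventures.PercRepro.C026DCSub
import Summits.Ventures.PercRepro.C026HubLike

/-!
# Theorem DP: the deletion–contraction defect of `Δ_CF` counts the doubly pivotal configurations (p6, gen 14)

mine-3's THEOREM DP (INBOX 6153; `proofs/MINE3-EDGEMONO.md` §1′): for an edge `e = uv` of `H = G + e`,
`Δ_CF(H) = Δ_CF(G) + Δ_CF(H / e) − #DP(e)`, where `DP(e)` is the set of configurations `Y` of `G` at which `e`
is OPEN-pivotal for `B = {c ↔ {a, b}}` (`B` holds with `e` open, fails with `e` closed) and CLOSED-pivotal for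
`A = {a ↔ b}` at the complement `Yᶜ` (`A` holds at `Yᶜ` with `e` open, fails with `e` closed).  The proof is
five lines from the closed form `Δ_CF = Σ_ω [B(ω)]·(2[Aᶜ(ω)] − [Aᶜ(ωᶜ)])` (`slackCF_eq_two_mul_sub`):
split the state of `e`, read the two slices in `G` and in `H / e`, and the difference is the product of the
two pivotality indicators (`indicator_dp`), a single `0/1` term by monotonicity.

In the tree's vocabulary `H / e = G.contract u v` (C026Contract; `u` a non-mark, the hypothesis of DC-SUB):

* `DoublyPivotal` — `DP(e)` at `Y`;
* **`slackCF_addEdge_dp`** — THEOREM DP;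
* **`card_doublyPivotal_eq_card_dcDefect`** — `DP(e)` is the tree's `DB(e)` (`DCDefect`, p5's C026DefectFlips)
  read at the complement: `#DP(e) = #DB(e)`, so DP is the uniform form of p5's `slackCF_addEdge` (DC-SUB).
-/

namespace PercRepro

open Finset

namespace MultiGraph

section DP

variable {V E : Type*} (G : MultiGraph V E)

/-- **Doubly pivotal**: `e = uv` is open-pivotal for `B = {c ↔ {a, b}}` at `Y` and closed-pivotal for
`A = {a ↔ b}` at `Yᶜ` (`G.contract u v` is the graph with `e` open, `G` the graph with `e` closed). -/
def DoublyPivotal (u v a b c : V) (Y : Config E) : Prop :=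
  ((G.contract u v).Conn Y c a ∨ (G.contract u v).Conn Y c b) ∧ ¬ (G.Conn Y c a ∨ G.Conn Y c b) ∧
    (G.contract u v).Conn Yᶜ a b ∧ ¬ G.Conn Yᶜ a b

variable {G}

/-- The product form of a configuration of `Option E` is its extension. -/
theorem piOption_symm_eq (s : Bool) (ω : Config E) :
    (Equiv.piOptionEquivProd (β := fun _ : Option E => Bool)).symm (s, ω) = extendOpt s ω := by
  funext i
  cases i <;> rfl

/-- p5's `card_filter_option` for arbitrary `Fintype` instances on the configuration spaces (the classical
counts of `slackCF` carry their own). -/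
theorem card_filter_option' [Fintype (Config (Option E))] [Fintype (Config E)]
    (Q : Config (Option E) → Prop) [DecidablePred Q] :
    (univ.filter Q).card =
      (univ.filter fun ω : Config E => Q (extendOpt false ω)).card +
        (univ.filter fun ω : Config E => Q (extendOpt true ω)).card := by
  rw [Finset.card_filter, Finset.card_filter, Finset.card_filter]
  rw [← Fintype.sum_equiv (Equiv.piOptionEquivProd (β := fun _ : Option E => Bool)).symm
    (fun p => if Q ((Equiv.piOptionEquivProd (β := fun _ : Option E => Bool)).symm p) then 1 else 0)
    (fun τ => if Q τ then 1 else 0) (fun _ => rfl), Fintype.sum_prod_type, Fintype.sum_bool, add_comm]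
  simp only [piOption_symm_eq]

/-- The pointwise bookkeeping of Theorem DP: with `x → x'` and `y' → y` (monotonicity in the state of `e`),
`[x][y] + [x'][y'] − [x][y'] − [x'][y] = −[x' ∧ ¬x ∧ y ∧ ¬y']`. -/
theorem indicator_dp (x x' y y' : Prop) [Decidable x] [Decidable x'] [Decidable y] [Decidable y']
    (h1 : x → x') (h2 : y' → y) :
    ((if x ∧ y then 1 else 0) + (if x' ∧ y' then 1 else 0) - (if x ∧ y' then 1 else 0) -
        (if x' ∧ y then 1 else 0) : ℤ) = -(if x' ∧ ¬ x ∧ y ∧ ¬ y' then 1 else 0) := by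
  by_cases hx : x <;> by_cases hx' : x' <;> by_cases hy : y <;> by_cases hy' : y' <;>
    simp [hx, hx', hy, hy'] <;>
    first
      | exact absurd (h1 hx) hx'
      | exact absurd (h2 hy') hy

open Classical in
/-- **THEOREM DP** (mine-3): `Δ_CF(G + uv) = Δ_CF(G) + Δ_CF(G / uv) − #DP(uv)` for every edge `uv` whose end
`u` is not a mark. -/
theorem slackCF_addEdge_dp [Fintype E] {u v : V} (huv : v ≠ u) {a b c : V} (ha : a ≠ u) (hb : b ≠ u)
    (hc : c ≠ u) :
    (G.addEdge u v).slackCF a b c =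
      G.slackCF a b c + (G.contract u v).slackCF a b c -
        ((univ.filter fun Y : Config E => G.DoublyPivotal u v a b c Y).card : ℤ) := by
  rw [slackCF_eq_two_mul_sub, slackCF_eq_two_mul_sub, slackCF_eq_two_mul_sub]
  simp only [card_filter_option']
  push_cast
  simp only [compl_extendOpt, Bool.not_false, Bool.not_true, conn_addEdge_closed_iff,
    conn_addEdge_open_iff_contract huv hc ha, conn_addEdge_open_iff_contract huv hc hb,
    conn_addEdge_open_iff_contract huv ha hb]
  simp only [card_filter_int]
  have hmonoB : ∀ Y : Config E, (G.Conn Y c a ∨ G.Conn Y c b) →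
      ((G.contract u v).Conn Y c a ∨ (G.contract u v).Conn Y c b) := by
    rintro Y (h | h)
    · exact Or.inl (conn_contract_of_conn_of_ne hc ha h)
    · exact Or.inr (conn_contract_of_conn_of_ne hc hb h)
  have hmonoA : ∀ Y : Config E, G.Conn Yᶜ a b → (G.contract u v).Conn Yᶜ a b := fun Y h =>
    conn_contract_of_conn_of_ne ha hb h
  have hpt : ∀ Y : Config E,
      ((if (G.Conn Y c a ∨ G.Conn Y c b) ∧ ¬ G.Conn Yᶜ a b then (1 : ℤ) else 0) +
        (if ((G.contract u v).Conn Y c a ∨ (G.contract u v).Conn Y c b) ∧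
          ¬ (G.contract u v).Conn Yᶜ a b then (1 : ℤ) else 0) -
        (if (G.Conn Y c a ∨ G.Conn Y c b) ∧ ¬ (G.contract u v).Conn Yᶜ a b then (1 : ℤ) else 0) -
        (if ((G.contract u v).Conn Y c a ∨ (G.contract u v).Conn Y c b) ∧ ¬ G.Conn Yᶜ a b
          then (1 : ℤ) else 0)) =
      -(if ((G.contract u v).Conn Y c a ∨ (G.contract u v).Conn Y c b) ∧
          ¬ (G.Conn Y c a ∨ G.Conn Y c b) ∧ ¬ G.Conn Yᶜ a b ∧ ¬ ¬ (G.contract u v).Conn Yᶜ a b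
        then (1 : ℤ) else 0) := fun Y =>
    indicator_dp _ _ _ _ (hmonoB Y) (fun h => (fun h' => h (hmonoA Y h')))
  have hsum := Finset.sum_congr rfl fun Y (_ : Y ∈ (univ : Finset (Config E))) => hpt Y
  simp only [Finset.sum_add_distrib, Finset.sum_sub_distrib, Finset.sum_neg_distrib] at hsum
  have hbridge : ∀ Y : Config E,
      (if ((G.contract u v).Conn Y c a ∨ (G.contract u v).Conn Y c b) ∧
          ¬ (G.Conn Y c a ∨ G.Conn Y c b) ∧ ¬ G.Conn Yᶜ a b ∧ ¬ ¬ (G.contract u v).Conn Yᶜ a b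
        then (1 : ℤ) else 0) = if G.DoublyPivotal u v a b c Y then (1 : ℤ) else 0 := by
    intro Y
    by_cases h : G.DoublyPivotal u v a b c Y
    · rw [if_pos h, if_pos]
      obtain ⟨h1, h2, h3, h4⟩ := h
      exact ⟨h1, h2, h4, not_not.mpr h3⟩
    · rw [if_neg h, if_neg]
      rintro ⟨h1, h2, h3, h4⟩
      exact h ⟨h1, h2, not_not.mp h4, h3⟩
  simp only [hbridge] at hsum
  linarith

open Classical in
/-- **`DP(e) = DB(e)`**: the doubly pivotal configurations are the tree's deletion–contraction defect
(`DCDefect`, p5) read at the complement, so `#DP(e) = #DB(e)` — Theorem DP is p5's DC-SUB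
`slackCF_addEdge` in uniform form. -/
theorem card_doublyPivotal_eq_card_dcDefect [Fintype E] {u v : V} (huv : v ≠ u) {a b c : V}
    (ha : a ≠ u) (hb : b ≠ u) (hc : c ≠ u) :
    (univ.filter fun Y : Config E => G.DoublyPivotal u v a b c Y).card =
      (univ.filter fun ω : Config E => G.DCDefect ω a b c u v).card := by
  rw [card_filter_compl (fun Y : Config E => G.DoublyPivotal u v a b c Y)]
  congr 1
  ext ω
  simp only [Finset.mem_filter, Finset.mem_univ, true_and]
  rw [dcDefect_iff huv ha hb hc]
  unfold DoublyPivotal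
  rw [compl_compl]
  constructor
  · rintro ⟨h1, h2, h3, h4⟩
    refine ⟨h4, h3, ⟨fun h => h2 (Or.inl h), fun h => h2 (Or.inr h)⟩, ?_⟩
    rintro ⟨h5, h6⟩
    rcases h1 with h | h
    · exact h5 h
    · exact h6 h
  · rintro ⟨h1, h2, ⟨h3, h4⟩, h5⟩
    refine ⟨?_, fun h => h.elim h3 h4, h2, h1⟩
    by_contra h
    exact h5 ⟨fun h' => h (Or.inl h'), fun h' => h (Or.inr h')⟩

end DP

end MultiGraph

end PercRepro
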